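import Literature.NumberTheory.Automorphic.BockleHuiIrreducibleGL3WeightProofs
import Literature.NumberTheory.Automorphic.CuspidalContragredientProofs
import Literature.NumberTheory.Automorphic.ArthurClozelGalOrbitLift
import HarnessLib

/-!
# Isobaric rigidity at unramified places (Jacquet–Shalika II, Thm. 4.4) for Borel–Jacquet data —
# preliminaries: unitary twists and the analytic package of a pair
(crux `IrreducibilityBySelfDuality.IrreducibleOffSector`, item stmt-Langlands-14329, line `Sketch`,
stub `stub_isobaricRigidity`; `--supports` file, imports Literature only)

**Statement** (`isobaricRigidity_of_JS`).  Let `π` be a cuspidal automorphic representation of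
`GL_n(𝔸_K)` (`n ≥ 1`, Borel–Jacquet datum, arbitrary central character) and `σ_1, …, σ_k`
(`k ≥ 2`) cuspidal automorphic representations of `GL_{m_i}(𝔸_K)`, `m_i ≥ 1`.  Then it is NOT the
case that at almost every finite place the Satake parameter of `π` is the multiset sum of Satake
parameters of the `σ_i` ("a cuspidal representation is not an isobaric sum of `k ≥ 2` cuspidal
representations": Jacquet–Shalika 1981 II, Thm. 4.4; Arthur–Clozel 1989, Ch. 3 (2.4)).

**Proof** (Jacquet–Shalika's pole count, run off the unitary axis as in
`BockleHuiIrreducibleGL3WeightProofs`).  Normalise: `t_π = q^{a} t_{π⁰}`, `t_{σ_i} = q^{b_i} t_{σ_i⁰}`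
with `π⁰`, `σ_i⁰` cuspidal data with UNITARY Satake families (Borel–Jacquet 5.7: unitary
normalisation `exists_normalisation_L2` + twist by `‖·‖^{re}`), `a, b_i ∈ ℝ`.  The hypothesis reads
`t_{π⁰} = ⊔_i q^{d_i} t_{σ_i⁰}`, `d_i = b_i - a`, whence `Σ m_i d_i = 0` (unit determinants) and
`d := max d_i ≥ 0`; fix `i₀` with `d_{i₀} = d` and the contragredient `σ̃` of `σ_{i₀}⁰`.  Off a large
finite `S` the Euler factors give, for `Re s > 1 + d`,
`L^S(s, π⁰ × σ̃) = ∏_i L^S(s - d_i, σ_i⁰ × σ̃)` (Jacquet–Shalika I Thm. 5.3 = Arthur–Clozel (2.1),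
PROVED in the tree).  As `s → 1 + d` inside `Re s > 1 + d`: the left side has a finite limit
(continuity at an interior point if `d > 0`; Arthur–Clozel (2.2) with `n ≠ m_{i₀}` if `d = 0`);
on the right the factors with `d_i < d` tend to non-zero values (interior point), those with
`d_i = d` either tend to a non-zero limit ((2.2)) or have a simple pole ((2.3)), and the factor
`i = i₀` HAS a pole ((2.3): `L^S(s, σ_{i₀}⁰ × σ̃_{i₀}⁰)` at `s = 1`).  Multiplying by the right
power of `(s - 1 - d)` gives `0 = ∏ cᵢ ≠ 0`.

Inputs: Arthur–Clozel (2.2) `JacquetShalika1981_partialPairL_boundary_repData` (= the route item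
`PairLBoundaryJS`, hypothesis), (2.3) `JacquetShalika1981_partialPairL_pole_repData` (named fact,
hypothesis); (2.1), the contragredient datum, the unitary normalisation, continuity/non-vanishing in
`Re s > 1` and Satake uniqueness/cofiniteness are THEOREMS of the tree.

References: H. Jacquet, J. Shalika, Amer. J. Math. 103 (1981), I Thm. 5.3, II Prop. 3.6, Thm. 4.4;
J. Arthur, L. Clozel, Ann. of Math. Stud. 120 (1989), Ch. 3 §2 (2.1)–(2.4); A. Borel, H. Jacquet,
PSPM 33.1 (1979), 5.7.
-/

noncomputable section

set_option linter.dupNamespace false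

open scoped Topology Classical NumberField
open NumberField IsDedekindDomain Filter Polynomial
open Literature.NumberTheory.Automorphic
open Literature.NumberTheory.GaloisRepresentations (HeckeCharacter ideleGroup)

namespace Summit.Langlands.Langlands.Theorems.IrreducibleOffSector

/-! ### Bookkeeping -/

section Bookkeeping

variable {K : Type} [Field K] [NumberField K]

/-- Outside any finite set of finite places of a number field there is a finite place. [folklore] -/
theorem exists_not_mem_of_finite {T : Set (HeightOneSpectrum (𝓞 K))} (hT : T.Finite) :
    ∃ w, w ∉ T := by
  haveI := infinite_heightOneSpectrum (K := K)
  obtain ⟨w, hw⟩ := hT.infinite_compl.nonempty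
  exact ⟨w, hw⟩

/-- `‖(q_v : ℂ) ^ z‖ = q_v ^ (re z)`. [folklore] -/
theorem norm_residueCard_cpow (v : HeightOneSpectrum (𝓞 K)) (z : ℂ) :
    ‖(v.residueCard : ℂ) ^ z‖ = (v.residueCard : ℝ) ^ z.re :=
  Complex.norm_natCast_cpow_of_pos (Nat.zero_lt_of_lt v.one_lt_residueCard) z

/-- `(q_v : ℂ) ^ z ≠ 0`. [folklore] -/
theorem residueCard_cpow_ne_zero (v : HeightOneSpectrum (𝓞 K)) (z : ℂ) :
    (v.residueCard : ℂ) ^ z ≠ 0 := fun h =>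
  natCast_residueCard_ne_zero v ((Complex.cpow_eq_zero_iff _ _).1 h).1

/-- `(β.map (c * ·)).map (d * ·) = β.map ((d * c) * ·)`. [folklore] -/
theorem map_const_mul_map_const_mul (β : Multiset ℂ) (c d : ℂ) :
    (β.map (c * ·)).map (d * ·) = β.map ((d * c) * ·) := by
  rw [Multiset.map_map]
  exact Multiset.map_congr rfl fun x _ => by simp [mul_assoc]

/-- The product of a finite sum of multisets is the product of the products. [folklore] -/
theorem prod_finset_sum_multiset {ι : Type*} (s : Finset ι) (β : ι → Multiset ℂ) :
    (∑ i ∈ s, β i).prod = ∏ i ∈ s, (β i).prod := by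
  classical
  induction s using Finset.induction_on with
  | empty => simp
  | insert i s hi ih => rw [Finset.sum_insert hi, Finset.prod_insert hi, Multiset.prod_add, ih]

/-- From `(q : ℝ) ^ x = 1` with `q > 1`: `x = 0`. [folklore] -/
theorem rpow_eq_one_iff_of_one_lt {q : ℕ} (hq : 1 < q) {x : ℝ} (h : (q : ℝ) ^ x = 1) : x = 0 := by
  have hq' : (1 : ℝ) < q := by exact_mod_cast hq
  rcases lt_trichotomy x 0 with hlt | heq | hgt
  · exact absurd h (ne_of_lt (Real.rpow_lt_one_of_one_lt_of_neg hq' hlt))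
  · exact heq
  · exact absurd h (ne_of_gt (Real.one_lt_rpow hq' hgt))

end Bookkeeping

/-! ### Unitary twists of cuspidal Borel–Jacquet data -/

section UnitaryTwist

variable {K : Type} [Field K] [NumberField K]

/-- **Unitary normalisation inside the Borel–Jacquet model.**  For a cuspidal Borel–Jacquet datum
`τ` on `GL_r(𝔸_K)` (`r ≥ 1`) there are a real number `a`, a cuspidal datum `τ⁰` on `GL_r(𝔸_K)` (at the
same level), a Satake family `γ` and a finite set `T` of places such that off `T`: `τ⁰` has Satake
parameter `γ_w`, `|∏ γ_w| = 1` (unitary central character), `γ_w` has `r` entries, and the Satake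
parameters of `τ` are exactly `q_w^{a} γ_w`.  Proof: the unitary normalisation
`t_{τ,w} = q_w^{s} t_{P,w}`, `P ≤ L²_cusp` (Borel–Jacquet 1979, 5.7, `exists_normalisation_L2`), and the
twist `τ⁰ = τ ⊗ ‖·‖^{re s}` (`exists_twist_hecke_hasSatakeParamAt`, `‖ϖ_w‖^{re s} = q_w^{-re s}`),
`a = re s`, `γ_w = q_w^{i im s} t_{P,w}`. [cite: BorelJacquetCorvallis1979, 5.7] -/
theorem exists_unitary_twist {r : ℕ} (hr : isCompact_glFiniteIntegralLevel r K) [NeZero r]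
    (τ : CuspidalAutomorphicRepData r K hr) :
    ∃ (a : ℝ) (τ₀ : CuspidalAutomorphicRepData r K hr) (γ : SatakeFamily K)
      (T : Set (HeightOneSpectrum (𝓞 K))), T.Finite ∧
      (∀ w ∉ T, τ₀.1.HasSatakeParamAt w (γ w)) ∧ (∀ w ∉ T, ‖(γ w).prod‖ = 1) ∧
      (∀ w ∉ T, Multiset.card (γ w) = r) ∧
      ∀ w ∉ T, ∀ δ : Multiset ℂ, τ.1.HasSatakeParamAt w δ →
        δ = (γ w).map (((w.residueCard : ℂ) ^ ((a : ℝ) : ℂ)) * ·) := by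
  obtain ⟨μ, hμ⟩ := AdelicGroupData.exists_isAutomorphicMeasure_gl_holds r K
  haveI := hμ
  obtain ⟨s, P, S, αP, hS, hαP, hiff⟩ := CuspidalAutomorphicRepData.exists_normalisation_L2 hr μ τ
  obtain ⟨χ, hχ⟩ := exists_heckeCharacter_ideleNorm_cpow K ((s.re : ℝ) : ℂ)
  obtain ⟨τ₀, hτ₀⟩ := CuspidalAutomorphicRepData.exists_twist_hecke_hasSatakeParamAt χ τ
  rw [Filter.eventually_cofinite] at hτ₀
  set E : Set (HeightOneSpectrum (𝓞 K)) := {v | ¬ ∀ α : Multiset ℂ, τ.1.HasSatakeParamAt v α →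
    τ₀.1.HasSatakeParamAt v (α.map (χ.valueAtUniformizer v * ·))} with hE
  refine ⟨s.re, τ₀, fun w => (αP w).map (((w.residueCard : ℂ) ^ (s - (s.re : ℂ))) * ·), S ∪ E,
    hS.union hτ₀, fun w hw => ?_, fun w hw => ?_, fun w hw => ?_, fun w hw δ hδ => ?_⟩
  · -- Satake parameters of the twist
    have hwS : w ∉ S := fun h => hw (Or.inl h)
    have hwE : w ∉ E := fun h => hw (Or.inr h)
    simp only [hE, Set.mem_setOf_eq, not_not] at hwE
    have h1 : τ.1.HasSatakeParamAt w ((αP w).map (((w.residueCard : ℂ) ^ s) * ·)) :=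
      (hiff w hwS _).2 rfl
    have h2 := hwE _ h1
    rw [HeckeCharacter.valueAtUniformizer_of_cpow hχ w, map_const_mul_map_const_mul] at h2
    have e : (αP w).map ((((w.residueCard : ℂ) ^ ((s.re : ℝ) : ℂ))⁻¹ * (w.residueCard : ℂ) ^ s) * ·) =
        (αP w).map (((w.residueCard : ℂ) ^ (s - (s.re : ℂ))) * ·) :=
      Multiset.map_congr rfl fun x _ => by
        rw [Complex.cpow_sub _ _ (natCast_residueCard_ne_zero w), div_eq_mul_inv]
        ring
    rw [e] at h2
    exact h2
  · -- unitarity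
    have hwS : w ∉ S := fun h => hw (Or.inl h)
    obtain ⟨𝔫, -, -, ϖ, hSat⟩ := hαP w hwS
    rw [prod_map_const_mul_eq, hSat.card_eq, norm_mul, norm_pow, hSat.norm_prod_eq_one, mul_one,
      norm_residueCard_cpow]
    simp
  · -- cardinality
    have hwS : w ∉ S := fun h => hw (Or.inl h)
    obtain ⟨𝔫, -, -, ϖ, hSat⟩ := hαP w hwS
    rw [Multiset.card_map, hSat.card_eq]
  · -- the shift
    have hwS : w ∉ S := fun h => hw (Or.inl h)
    rw [(hiff w hwS δ).1 hδ, map_const_mul_map_const_mul]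
    refine Multiset.map_congr rfl fun x _ => ?_
    congr 1
    rw [← Complex.cpow_add _ _ (natCast_residueCard_ne_zero w)]
    congr 1
    ring

/-- Transport of a cuspidal datum along an equality of ranks (the level witnesses are
propositions, hence interchangeable). [folklore] -/
theorem exists_transport_rank {r r' : ℕ} (e : r = r') (h : isCompact_glFiniteIntegralLevel r K)
    (h' : isCompact_glFiniteIntegralLevel r' K) (τ : CuspidalAutomorphicRepData r K h) :
    ∃ τ' : CuspidalAutomorphicRepData r' K h',
      ∀ (v : HeightOneSpectrum (𝓞 K)) (δ : Multiset ℂ),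
        τ.1.HasSatakeParamAt v δ ↔ τ'.1.HasSatakeParamAt v δ := by
  subst e
  exact ⟨τ, fun _ _ => Iff.rfl⟩

end UnitaryTwist

/-! ### The analytic package of a pair of cuspidal Borel–Jacquet data -/

section Package

/-- **The analytic package of a pair** `(τ, τ')` of cuspidal Borel–Jacquet data on
`GL_r × GL_{r'}` (`r, r' ≥ 1`): off one finite `S₀`, for all unitary Satake families `γ`, `γ'` of
`τ`, `τ'` off `S ⊇ S₀`, (i) the Euler product `L^S(s, γ ⊗ γ')` is multipliable on `Re s > 1`
(Arthur–Clozel (2.1), a theorem: `JacquetShalika1981_multipliable_partialPairL_repData_holds`),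
(ii) it is continuous and non-zero at every point of `Re s > 1`
(`continuousAt_and_ne_zero_partialPairL_repData`, a theorem), (iii) off the `X`-condition at
`s₀ = 1` it has a finite non-zero limit at `1` (Arthur–Clozel (2.2), hypothesis) and (iv) on it a
simple pole (Arthur–Clozel (2.3), hypothesis; the `X`-condition forces `r = r'`, along which `τ`
is transported). [cite: ArthurClozelAMS120, Ch. 3 §2 (2.1)–(2.3)] -/
theorem exists_analyticPackage
    (h22 : JacquetShalika1981_partialPairL_boundary_repData)
    (h23 : JacquetShalika1981_partialPairL_pole_repData)
    {K : Type} [Field K] [NumberField K]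
    {r r' : ℕ} [NeZero r] [NeZero r'] {hr : isCompact_glFiniteIntegralLevel r K}
    {hr' : isCompact_glFiniteIntegralLevel r' K}
    (τ : CuspidalAutomorphicRepData r K hr) (τ' : CuspidalAutomorphicRepData r' K hr') :
    ∃ S₀ : Set (HeightOneSpectrum (𝓞 K)), S₀.Finite ∧
      ∀ {S : Set (HeightOneSpectrum (𝓞 K))} (_hS : S.Finite) (_hS₀ : S₀ ⊆ S)
        {γ γ' : SatakeFamily K} (_hγ : ∀ w ∉ S, τ.1.HasSatakeParamAt w (γ w))
        (_hγ' : ∀ w ∉ S, τ'.1.HasSatakeParamAt w (γ' w))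
        (_hu : ∀ w ∉ S, ‖(γ w).prod‖ = 1) (_hu' : ∀ w ∉ S, ‖(γ' w).prod‖ = 1),
        (∀ s : ℂ, 1 < s.re → Multipliable fun v : {v : HeightOneSpectrum (𝓞 K) // v ∉ S} =>
          ((satakePairPolynomial (γ v.1) (γ' v.1)).eval ((v.1.residueCard : ℂ) ^ (-s)))⁻¹) ∧
        (∀ s : ℂ, 1 < s.re → ContinuousAt (partialPairL S γ γ') s ∧ partialPairL S γ γ' s ≠ 0) ∧
        (¬ (r = r' ∧ ∀ᶠ w in cofinite, (γ w).map (((w.residueCard : ℂ) ^ (1 - (1 : ℂ))) * ·) =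
            (γ' w).map (·⁻¹)) →
          ∃ c : ℂ, c ≠ 0 ∧ Tendsto (partialPairL S γ γ') (𝓝[{s : ℂ | 1 < s.re}] 1) (𝓝 c)) ∧
        ((r = r' ∧ ∀ᶠ w in cofinite, (γ w).map (((w.residueCard : ℂ) ^ (1 - (1 : ℂ))) * ·) =
            (γ' w).map (·⁻¹)) →
          ∃ c : ℂ, c ≠ 0 ∧ Tendsto (fun s => (s - 1) * partialPairL S γ γ' s)
            (𝓝[{s : ℂ | 1 < s.re}] 1) (𝓝 c)) := by
  have hrpos : 0 < r := Nat.pos_of_ne_zero (NeZero.ne r)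
  have hr'pos : 0 < r' := Nat.pos_of_ne_zero (NeZero.ne r')
  obtain ⟨S₁, hS₁, h1⟩ :=
    JacquetShalika1981_multipliable_partialPairL_repData_holds r r' K hr hr' hrpos hr'pos τ τ'
  obtain ⟨S₂, hS₂, h2⟩ := continuousAt_and_ne_zero_partialPairL_repData τ τ'
  obtain ⟨S₃, hS₃, h3⟩ := h22 r r' K hr hr' hrpos hr'pos τ τ'
  have hone : (1 : ℂ).re = 1 := Complex.one_re
  by_cases e : r = r'
  · -- same rank: the pole clause is available after transport
    obtain ⟨τ₁, hτ₁⟩ := exists_transport_rank e hr hr' τ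
    obtain ⟨S₄, hS₄, h4⟩ := h23 r' K hr' hr'pos τ₁ τ'
    refine ⟨S₁ ∪ S₂ ∪ S₃ ∪ S₄, ((hS₁.union hS₂).union hS₃).union hS₄, ?_⟩
    intro S hS hS₀ γ γ' hγ hγ' hu hu'
    have hS₁S : S₁ ⊆ S := fun x hx => hS₀ (Or.inl (Or.inl (Or.inl hx)))
    have hS₂S : S₂ ⊆ S := fun x hx => hS₀ (Or.inl (Or.inl (Or.inr hx)))
    have hS₃S : S₃ ⊆ S := fun x hx => hS₀ (Or.inl (Or.inr hx))
    have hS₄S : S₄ ⊆ S := fun x hx => hS₀ (Or.inr hx)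
    refine ⟨fun s hs => h1 hS hS₁S hγ hγ' hu hu' hs, fun s hs => h2 hS hS₂S hγ hγ' hu hu' hs,
      fun hX => h3 hS hS₃S hγ hγ' hu hu' hone hX, fun hX => ?_⟩
    have hγ₁ : ∀ w ∉ S, τ₁.1.HasSatakeParamAt w (γ w) := fun w hw => (hτ₁ w (γ w)).1 (hγ w hw)
    exact h4 hS hS₄S hγ₁ hγ' hu hu' hone hX.2
  · refine ⟨S₁ ∪ S₂ ∪ S₃, (hS₁.union hS₂).union hS₃, ?_⟩
    intro S hS hS₀ γ γ' hγ hγ' hu hu'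
    have hS₁S : S₁ ⊆ S := fun x hx => hS₀ (Or.inl (Or.inl hx))
    have hS₂S : S₂ ⊆ S := fun x hx => hS₀ (Or.inl (Or.inr hx))
    have hS₃S : S₃ ⊆ S := fun x hx => hS₀ (Or.inr hx)
    exact ⟨fun s hs => h1 hS hS₁S hγ hγ' hu hu' hs, fun s hs => h2 hS hS₂S hγ hγ' hu hu' hs,
      fun hX => h3 hS hS₃S hγ hγ' hu hu' hone hX, fun hX => absurd hX.1 e⟩

end Package

/-! ### More bookkeeping -/

section Bookkeeping2

variable {K : Type} [Field K] [NumberField K]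

/-- `Multiset.map` commutes with finite sums of multisets. [folklore] -/
theorem map_finset_sum_multiset {ι : Type*} (s : Finset ι) (β : ι → Multiset ℂ) (f : ℂ → ℂ) :
    (∑ i ∈ s, β i).map f = ∑ i ∈ s, (β i).map f :=
  map_sum (Multiset.mapAddMonoidHom f) β s

/-- The cardinality of a finite sum of multisets. [folklore] -/
theorem card_finset_sum_multiset {ι : Type*} (s : Finset ι) (β : ι → Multiset ℂ) :
    Multiset.card (∑ i ∈ s, β i) = ∑ i ∈ s, Multiset.card (β i) :=
  map_sum Multiset.cardHom β s

/-- The boundary filter of an open right half-plane at a boundary point is non-trivial. [folklore] -/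
theorem neBot_nhdsWithin_lt_re (x : ℝ) : (𝓝[{s : ℂ | x < s.re}] (x : ℂ)).NeBot := by
  rw [← mem_closure_iff_nhdsWithin_neBot, Complex.closure_setOf_lt_re]
  simp

end Bookkeeping2

end Summit.Langlands.Langlands.Theorems.IrreducibleOffSector

end
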